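import Summits.QuantumFields.BalabanUV.Beta.GAN24.ExponentialChartJets
import Summits.QuantumFields.BalabanUV.Beta.GAN24.ExponentialChartMixedBackgrounds

/-!
# `BalabanUV.Beta.GAN24.ExponentialChartBaseJets` — binder row G-an2-4 ∕ (CONV-C), route R7 «TWO CURRENCIES», PART 265: BAŁABAN's CHART AT A BASE POINT.  For REAL connections
# `A₀` (the base) and `B` (the direction) the chart `U_s = exp(iη(A₀ + sB)) = U₀·exp(isηB)` through `U₀ = e^{iηA₀} ≠ 1` has the closed forms `−w_s = n − n·e^{θ₀ + θs}`
# (`θ₀ = iA₀∕n`, `θ = iB∕n`) and `z_s = −n²Σ_ν(e^{θ₀+θs} + e^{−θ₀−θs} − 2)` (UNSHIFTED, as at the identity), and its jets at `s = 0` are the identity-base jets of PART 245 TWISTED BY THE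
# BASE PHASE: `∂^j_s(−w_s)|₀ = −n·e^{θ₀}θ^j`, `∂^j_s z_s|₀ = −n²Σ_ν(e^{θ₀}θ^j + e^{−θ₀}(−θ)^j)` (`j ≥ 1`).  With NE2's EXACT `covPert_eq`, `Δ^{U_s} − Δ^1 = (Δ^{U₀} − Δ^1) + [P(V_s − V₀) +
# P(V_s − V₀)ᴴ + diag(z_s − z₀)]` (§4, for ANY two transporter fields): along the chart the operator is the BASE coupling letter `Δ^{U₀} − Δ^1` (PART 264's `A₀` at `u = 1`) plus a
# coupling-letter curve vanishing at `s = 0` whose jets are the twisted ones — the letters of the Taylor coefficients of the effective form AT `U₀` (PART 264 gives every diagram in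
# them the END; PART 251 the mixed second partial from separate jets) (unit b2b-balaban-gan24-p3, gen 67; v1)

NOT IN PRINT; OUR PROOF ([folklore] one-variable calculus BY NAME over PART 245 (`iteratedDeriv_const_mul_cexp`, `deriv_const_sub_const_mul_cexp`, `iteratedDeriv_sum_two_cexp`,
`hasDerivAt_cexp_mul_ofReal`, `conj_theta`), PART 253 (`Pmodel_add'`'s pattern: `Pmodel_apply`), NE2's `covPert_eq`, `connV`, `zT`; Mathlib's `Complex.exp_add`, `Complex.exp_conj`,
`iteratedDeriv_succ'`; [Balaban1985BackgroundPropagators] (3.3) p. 390 and [Balaban1987RG1] (1.20) p. 264 LOCATE the chart `U = e^{iηA}`; nothing printed is a hypothesis).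
HONEST FRAMING (cell contract, verbatim): «discharging `BetaPertH` makes Bałaban's UV stability UNCONDITIONAL — a real constructive-QFT result; it is NOT the
continuum limit and NOT the Clay problem.»  HONEST DEPENDENCY (verbatim): «continuum YM on T⁴ ⇐ BetaPertH ∧ nine spine estimates (0/9 proved); BetaPertH ⇐
(D1) ∧ (D4) ∧ CAP+tail; G-an2-4 gates asym, D1 and NE2/3/4.»

WHAT THIS FILE PROVES (0 sorry, 0 `def`; `U_s k ν x = exp(I·A₀ k ν x∕n_k + (I·B k ν x∕n_k)·s)`, `A₀, B` REAL):
* §1 `cexp_neg_add_mul_cexp`, `star_conn_expChartAt`; §2 **`connV_expChartAt`**, **`zT_expChartAt`** (closed forms; `z` UNSHIFTED);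
* §3 **`iteratedDeriv_connV_expChartAt`**, **`iteratedDeriv_zT_expChartAt`** (the jets at `s = 0`: PART 245's jets twisted by `e^{±θ₀}`);
* §4 (ANY transporter fields `u, u′`) `Pmodel_sub'`, **`covPert_sub_covPert`**, **`covPert_eq_base_add`**: `covPert u = covPert u′ + [P(V_u − V_{u′}) + P(V_u − V_{u′})ᴴ + diag(z_u − z_{u′})]`.
WHAT IT DOES NOT DO: the Lipschitz ∕ bounded-background constants of the twisted jets and the Hessian at `U₀` as a diagram combination with the END (successor, over PARTs 251 ∕ 264);
colour; Bałaban's `−∂P∂*` ∕ `aQ(U)*Q(U)` parts.  SUPPLIER work; NEVER «G-an2-4 closed»; NOT (CONV-C), NOT D1, NOT `BetaPertH`, NOT continuum, NOT Clay.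
Records: `HOME/b2b-balaban-gan24-p3/gen67/README.md`.
-/

noncomputable section

open scoped BigOperators ComplexConjugate Matrix Matrix.Norms.L2Operator
open Filter Topology

namespace Summit.QuantumFields.BalabanUV.Beta.GAN24.ExponentialChartBaseJets

open Literature.MathematicalPhysics.QuantumFieldTheory.Balaban1983to89
open Literature.MathematicalPhysics.QuantumFieldTheory.Balaban1983to89.B5Prop11Plancherel (Tor fine)
open Literature.MathematicalPhysics.QuantumFieldTheory.Balaban1983to89.B5G183RateUnitTower (lev)
open Summit.QuantumFields.BalabanUV.T4Continuum
open Summit.QuantumFields.BalabanUV.T4Continuum.BalabanAveragedTowerUnit (idx)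
open Summit.QuantumFields.BalabanUV.T4Continuum.FirstOrderBackgroundModel (Pmodel)
open Summit.QuantumFields.BalabanUV.T4Continuum.AbelianCovariantLaplacian (covPert covPert_eq connV zT conn zfield negConn tauInv)
open Summit.QuantumFields.BalabanUV.Beta.GAN24.CouplingCurveTaylor (Pmodel_apply)
open Summit.QuantumFields.BalabanUV.Beta.GAN24.ExponentialChartJets (hasDerivAt_const_mul_cexp hasDerivAt_cexp_mul_ofReal iteratedDeriv_const_mul_cexp iteratedDeriv_sum_two_cexp
  deriv_const_sub_const_mul_cexp conj_theta)

/-! ## §1 Scalar pieces: the base phase -/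

section Scalar

/-- `e^{−p−qz}·e^{p+qz} = 1`. [folklore] -/
theorem cexp_neg_add_mul_cexp (p q z : ℂ) : Complex.exp (-p + -q * z) * Complex.exp (p + q * z) = 1 := by
  rw [← Complex.exp_add, show -p + -q * z + (p + q * z) = 0 by ring, Complex.exp_zero]

/-- `(n(e^{θ₀+θs} − 1))* = n(e^{−θ₀−θs} − 1)` for `θ₀ = I·a₀∕n`, `θ = I·a∕n`, real `a₀, a, s`. [folklore] -/
theorem star_conn_expChartAt (a₀ a : ℝ) (n : ℕ) (s : ℝ) :
    star (((n : ℕ) : ℂ) * (Complex.exp (Complex.I * (a₀ : ℂ) / ((n : ℕ) : ℂ) + (Complex.I * (a : ℂ) / ((n : ℕ) : ℂ)) * (s : ℂ)) - 1))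
      = ((n : ℕ) : ℂ) * (Complex.exp (-(Complex.I * (a₀ : ℂ) / ((n : ℕ) : ℂ)) + -(Complex.I * (a : ℂ) / ((n : ℕ) : ℂ)) * (s : ℂ)) - 1) := by
  rw [Complex.star_def, map_mul, map_natCast, map_sub, map_one, ← Complex.exp_conj, map_add, map_mul, conj_theta, conj_theta, Complex.conj_ofReal]

/-- `e^{θ₀+θs} = e^{θ₀}·e^{θs}` as functions of the real parameter. [folklore] -/
theorem cexp_add_mul_eq (θ₀ θ : ℂ) : (fun v : ℝ => Complex.exp (θ₀ + θ * (v : ℂ))) = fun v : ℝ => Complex.exp θ₀ * Complex.exp (θ * (v : ℂ)) := by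
  funext v
  rw [Complex.exp_add]

end Scalar

/-! ## §2 The chart at a base point: connection and zeroth-order field in closed form -/

section Chart

variable {d : ℕ} (L : ℕ) [NeZero L] (M : Fin d → ℕ) [hM : ∀ μ, NeZero (M μ)]

omit [NeZero L] hM in
/-- **`connV_expChartAt`**: `−w_s = n − n·e^{θ₀ + θs}`, `θ₀ = I·A₀∕n`, `θ = I·B∕n`, at every level. [folklore] -/
theorem connV_expChartAt (A₀ B : (k : ℕ) → Fin d → (idx L M k → ℝ)) (s : ℝ) :
    connV L M (fun k ν x => Complex.exp (Complex.I * (A₀ k ν x : ℂ) / ((lev L k : ℕ) : ℂ) + (Complex.I * (B k ν x : ℂ) / ((lev L k : ℕ) : ℂ)) * (s : ℂ)))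
      = fun k ν x => ((lev L k : ℕ) : ℂ)
          - ((lev L k : ℕ) : ℂ) * Complex.exp (Complex.I * (A₀ k ν x : ℂ) / ((lev L k : ℕ) : ℂ) + (Complex.I * (B k ν x : ℂ) / ((lev L k : ℕ) : ℂ)) * (s : ℂ)) := by
  funext k ν x
  simp only [connV, negConn, conn]
  ring

omit [NeZero L] hM in
/-- **`zT_expChartAt`**: for REAL `A₀, B` the zeroth-order field along the chart at the base point is UNSHIFTED:
`z_s(x) = −n²·Σ_ν (e^{θ₀,ν(x) + θ_ν(x)s} + e^{−θ₀,ν(x) − θ_ν(x)s} − 2)` (the `τ_ν⁻¹`-terms of NE2's `zfield` cancel by `e^{−Θ}e^{Θ} = 1`; PART 245 is `A₀ = 0`). [folklore] -/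
theorem zT_expChartAt (A₀ B : (k : ℕ) → Fin d → (idx L M k → ℝ)) (s : ℝ) :
    zT L M (fun k ν x => Complex.exp (Complex.I * (A₀ k ν x : ℂ) / ((lev L k : ℕ) : ℂ) + (Complex.I * (B k ν x : ℂ) / ((lev L k : ℕ) : ℂ)) * (s : ℂ)))
      = fun k x => -((lev L k : ℕ) : ℂ) ^ 2 * ∑ ν, (Complex.exp (Complex.I * (A₀ k ν x : ℂ) / ((lev L k : ℕ) : ℂ) + (Complex.I * (B k ν x : ℂ) / ((lev L k : ℕ) : ℂ)) * (s : ℂ))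
          + Complex.exp (-(Complex.I * (A₀ k ν x : ℂ) / ((lev L k : ℕ) : ℂ)) + -(Complex.I * (B k ν x : ℂ) / ((lev L k : ℕ) : ℂ)) * (s : ℂ)) - 2) := by
  funext k x
  simp only [zT, zfield, conn]
  rw [Finset.mul_sum]
  refine Finset.sum_congr rfl fun ν _ => ?_
  rw [star_conn_expChartAt, star_conn_expChartAt]
  linear_combination (((lev L k : ℕ) : ℂ) ^ 2)
    * cexp_neg_add_mul_cexp (Complex.I * (A₀ k ν (tauInv (fine (lev L k) M) ν x) : ℂ) / ((lev L k : ℕ) : ℂ))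
        (Complex.I * (B k ν (tauInv (fine (lev L k) M) ν x) : ℂ) / ((lev L k : ℕ) : ℂ)) (s : ℂ)

end Chart

/-! ## §3 The jets at `s = 0`: PART 245's jets twisted by the base phase -/

section Jets

variable {d : ℕ} (L : ℕ) [NeZero L] (M : Fin d → ℕ) [hM : ∀ μ, NeZero (M μ)]

omit [NeZero L] hM in
/-- **`iteratedDeriv_connV_expChartAt`**: `∂^j_s(−w_s)^{(k)}_ν(x)|₀ = n_k − n_ke^{θ₀}` (`j = 0`), `= −n_k·e^{θ₀}·θ^j` (`j ≥ 1`), `θ₀ = I·A₀^{(k)}_ν(x)∕n_k`, `θ = I·B^{(k)}_ν(x)∕n_k`.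
[folklore] -/
theorem iteratedDeriv_connV_expChartAt (A₀ B : (k : ℕ) → Fin d → (idx L M k → ℝ)) (j k : ℕ) (ν : Fin d) (x : idx L M k) :
    iteratedDeriv j (fun s : ℝ => connV L M (fun k' ν' x' => Complex.exp (Complex.I * (A₀ k' ν' x' : ℂ) / ((lev L k' : ℕ) : ℂ)
        + (Complex.I * (B k' ν' x' : ℂ) / ((lev L k' : ℕ) : ℂ)) * (s : ℂ))) k ν x) 0
      = if j = 0 then ((lev L k : ℕ) : ℂ) - ((lev L k : ℕ) : ℂ) * Complex.exp (Complex.I * (A₀ k ν x : ℂ) / ((lev L k : ℕ) : ℂ))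
        else -(((lev L k : ℕ) : ℂ) * Complex.exp (Complex.I * (A₀ k ν x : ℂ) / ((lev L k : ℕ) : ℂ)) * (Complex.I * (B k ν x : ℂ) / ((lev L k : ℕ) : ℂ)) ^ j) := by
  simp only [connV_expChartAt]
  have e : (fun s : ℝ => ((lev L k : ℕ) : ℂ) - ((lev L k : ℕ) : ℂ) * Complex.exp (Complex.I * (A₀ k ν x : ℂ) / ((lev L k : ℕ) : ℂ)
        + (Complex.I * (B k ν x : ℂ) / ((lev L k : ℕ) : ℂ)) * (s : ℂ)))
      = fun s : ℝ => ((lev L k : ℕ) : ℂ) - (((lev L k : ℕ) : ℂ) * Complex.exp (Complex.I * (A₀ k ν x : ℂ) / ((lev L k : ℕ) : ℂ)))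
        * Complex.exp ((Complex.I * (B k ν x : ℂ) / ((lev L k : ℕ) : ℂ)) * (s : ℂ)) := by
    funext s
    rw [Complex.exp_add]
    ring
  rw [e]
  rcases j with _ | j
  · simp [iteratedDeriv_zero]
  · rw [iteratedDeriv_succ', deriv_const_sub_const_mul_cexp, iteratedDeriv_const_mul_cexp]
    simp only [Nat.succ_ne_zero, if_false, Complex.ofReal_zero, mul_zero, Complex.exp_zero, mul_one]
    ring

omit [NeZero L] hM in
/-- **`iteratedDeriv_zT_expChartAt`**: `∂^j_s z^{(k)}_s(x)|₀ = −n_k²·Σ_ν (e^{θ₀,ν} + e^{−θ₀,ν} − 2)` (`j = 0`), `= −n_k²·Σ_ν (e^{θ₀,ν}θ_ν^j + e^{−θ₀,ν}(−θ_ν)^j)` (`j ≥ 1`). [folklore] -/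
theorem iteratedDeriv_zT_expChartAt (A₀ B : (k : ℕ) → Fin d → (idx L M k → ℝ)) (j k : ℕ) (x : idx L M k) :
    iteratedDeriv j (fun s : ℝ => zT L M (fun k' ν' x' => Complex.exp (Complex.I * (A₀ k' ν' x' : ℂ) / ((lev L k' : ℕ) : ℂ)
        + (Complex.I * (B k' ν' x' : ℂ) / ((lev L k' : ℕ) : ℂ)) * (s : ℂ))) k x) 0
      = if j = 0 then -((lev L k : ℕ) : ℂ) ^ 2 * ∑ ν, (Complex.exp (Complex.I * (A₀ k ν x : ℂ) / ((lev L k : ℕ) : ℂ))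
          + Complex.exp (-(Complex.I * (A₀ k ν x : ℂ) / ((lev L k : ℕ) : ℂ))) - 2)
        else -((lev L k : ℕ) : ℂ) ^ 2 * ∑ ν, (Complex.exp (Complex.I * (A₀ k ν x : ℂ) / ((lev L k : ℕ) : ℂ)) * (Complex.I * (B k ν x : ℂ) / ((lev L k : ℕ) : ℂ)) ^ j
          + Complex.exp (-(Complex.I * (A₀ k ν x : ℂ) / ((lev L k : ℕ) : ℂ))) * (-(Complex.I * (B k ν x : ℂ) / ((lev L k : ℕ) : ℂ))) ^ j) := by
  simp only [zT_expChartAt]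
  rcases j with _ | j
  · simp only [iteratedDeriv_zero, Complex.ofReal_zero, mul_zero, add_zero, if_true]
  · -- product form of the exponentials, strip one derivative (the constant `−2` drops), then the two-exponential sum formula
    have e : (fun s : ℝ => -((lev L k : ℕ) : ℂ) ^ 2 * ∑ ν, (Complex.exp (Complex.I * (A₀ k ν x : ℂ) / ((lev L k : ℕ) : ℂ)
            + (Complex.I * (B k ν x : ℂ) / ((lev L k : ℕ) : ℂ)) * (s : ℂ))
          + Complex.exp (-(Complex.I * (A₀ k ν x : ℂ) / ((lev L k : ℕ) : ℂ)) + -(Complex.I * (B k ν x : ℂ) / ((lev L k : ℕ) : ℂ)) * (s : ℂ)) - 2))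
        = fun s : ℝ => -((lev L k : ℕ) : ℂ) ^ 2 * ∑ ν, (Complex.exp (Complex.I * (A₀ k ν x : ℂ) / ((lev L k : ℕ) : ℂ))
            * Complex.exp ((Complex.I * (B k ν x : ℂ) / ((lev L k : ℕ) : ℂ)) * (s : ℂ))
          + Complex.exp (-(Complex.I * (A₀ k ν x : ℂ) / ((lev L k : ℕ) : ℂ))) * Complex.exp (-(Complex.I * (B k ν x : ℂ) / ((lev L k : ℕ) : ℂ)) * (s : ℂ)) - 2) := by
      funext s
      simp only [Complex.exp_add]
    rw [e, iteratedDeriv_succ']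
    have hd : deriv (fun s : ℝ => -((lev L k : ℕ) : ℂ) ^ 2 * ∑ ν, (Complex.exp (Complex.I * (A₀ k ν x : ℂ) / ((lev L k : ℕ) : ℂ))
            * Complex.exp ((Complex.I * (B k ν x : ℂ) / ((lev L k : ℕ) : ℂ)) * (s : ℂ))
          + Complex.exp (-(Complex.I * (A₀ k ν x : ℂ) / ((lev L k : ℕ) : ℂ))) * Complex.exp (-(Complex.I * (B k ν x : ℂ) / ((lev L k : ℕ) : ℂ)) * (s : ℂ)) - 2))
        = fun s : ℝ => ∑ ν, ((-((lev L k : ℕ) : ℂ) ^ 2 * Complex.exp (Complex.I * (A₀ k ν x : ℂ) / ((lev L k : ℕ) : ℂ)) * (Complex.I * (B k ν x : ℂ) / ((lev L k : ℕ) : ℂ)))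
            * Complex.exp ((Complex.I * (B k ν x : ℂ) / ((lev L k : ℕ) : ℂ)) * (s : ℂ))
          + (((lev L k : ℕ) : ℂ) ^ 2 * Complex.exp (-(Complex.I * (A₀ k ν x : ℂ) / ((lev L k : ℕ) : ℂ))) * (Complex.I * (B k ν x : ℂ) / ((lev L k : ℕ) : ℂ)))
            * Complex.exp (-(Complex.I * (B k ν x : ℂ) / ((lev L k : ℕ) : ℂ)) * (s : ℂ))) := by
      funext s
      have h : HasDerivAt (fun s : ℝ => -((lev L k : ℕ) : ℂ) ^ 2 * ∑ ν, (Complex.exp (Complex.I * (A₀ k ν x : ℂ) / ((lev L k : ℕ) : ℂ))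
              * Complex.exp ((Complex.I * (B k ν x : ℂ) / ((lev L k : ℕ) : ℂ)) * (s : ℂ))
            + Complex.exp (-(Complex.I * (A₀ k ν x : ℂ) / ((lev L k : ℕ) : ℂ))) * Complex.exp (-(Complex.I * (B k ν x : ℂ) / ((lev L k : ℕ) : ℂ)) * (s : ℂ)) - 2))
          (-((lev L k : ℕ) : ℂ) ^ 2 * ∑ ν, (Complex.exp (Complex.I * (A₀ k ν x : ℂ) / ((lev L k : ℕ) : ℂ))
              * ((Complex.I * (B k ν x : ℂ) / ((lev L k : ℕ) : ℂ)) * Complex.exp ((Complex.I * (B k ν x : ℂ) / ((lev L k : ℕ) : ℂ)) * (s : ℂ)))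
            + Complex.exp (-(Complex.I * (A₀ k ν x : ℂ) / ((lev L k : ℕ) : ℂ)))
              * (-(Complex.I * (B k ν x : ℂ) / ((lev L k : ℕ) : ℂ)) * Complex.exp (-(Complex.I * (B k ν x : ℂ) / ((lev L k : ℕ) : ℂ)) * (s : ℂ))))) s :=
        (HasDerivAt.fun_sum fun ν _ => (((hasDerivAt_cexp_mul_ofReal _ s).const_mul _).fun_add ((hasDerivAt_cexp_mul_ofReal _ s).const_mul _)).sub_const
          (2 : ℂ)).const_mul _
      rw [h.deriv, Finset.mul_sum]
      refine Finset.sum_congr rfl fun ν _ => ?_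
      ring
    rw [hd, iteratedDeriv_sum_two_cexp]
    simp only [Nat.succ_ne_zero, if_false, Complex.ofReal_zero, mul_zero, Complex.exp_zero, mul_one, Finset.mul_sum]
    refine Finset.sum_congr rfl fun ν _ => ?_
    ring

end Jets

/-! ## §4 The operator along the chart: the base coupling letter plus a coupling-letter increment (ANY two transporter fields) -/

section Increment

variable {d : ℕ} (L : ℕ) [NeZero L] (M : Fin d → ℕ) [hM : ∀ μ, NeZero (M μ)]

/-- the first-order coupling is subtractive in the background (PART 253's `Pmodel_add'` pattern). [folklore] -/
theorem Pmodel_sub' (V V' : (k : ℕ) → Fin d → (idx L M k → ℂ)) (k : ℕ) :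
    Pmodel L M (fun k ν x => V k ν x - V' k ν x) k = Pmodel L M V k - Pmodel L M V' k := by
  ext a b
  simp only [Matrix.sub_apply, Pmodel_apply, sub_mul, Finset.sum_sub_distrib]

/-- **`covPert_sub_covPert`** — for ANY two transporter fields `u, u′`: `(Δ^{u} − Δ^1) − (Δ^{u′} − Δ^1) = P(V_u − V_{u′}) + P(V_u − V_{u′})ᴴ + diag(z_u − z_{u′})`, a coupling letter
(NE2's EXACT `covPert_eq` twice; `V = connV`, `z = zT`). [our proof] -/
theorem covPert_sub_covPert (u u' : (k : ℕ) → Fin d → (idx L M k → ℂ)) (k : ℕ) :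
    covPert L M u k - covPert L M u' k
      = Pmodel L M (fun k ν x => connV L M u k ν x - connV L M u' k ν x) k + (Pmodel L M (fun k ν x => connV L M u k ν x - connV L M u' k ν x) k)ᴴ
        + Matrix.diagonal (fun x => zT L M u k x - zT L M u' k x) := by
  rw [covPert_eq, covPert_eq, Pmodel_sub', Matrix.conjTranspose_sub]
  have e : Matrix.diagonal (fun x => zT L M u k x - zT L M u' k x) = Matrix.diagonal (zT L M u k) - Matrix.diagonal (zT L M u' k) := by
    exact (Matrix.diagonal_sub _ _).symm
  rw [e]
  abel

/-- **`covPert_eq_base_add`** — THE OPERATOR ALONG ANY CHART IS THE BASE COUPLING LETTER PLUS A COUPLING-LETTER INCREMENT: `Δ^{u} − Δ^1 = (Δ^{u′} − Δ^1) + [P(V_u − V_{u′}) +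
P(V_u − V_{u′})ᴴ + diag(z_u − z_{u′})]` — with `u = U_s`, `u′ = U₀` the increment vanishes at `s = 0` and its `s`-jets are §3's twisted jets (PART 264's base letter `A₀ = Δ^{U₀} − Δ^1` at
`u = 1`). [our proof] -/
theorem covPert_eq_base_add (u u' : (k : ℕ) → Fin d → (idx L M k → ℂ)) (k : ℕ) :
    covPert L M u k
      = covPert L M u' k + (Pmodel L M (fun k ν x => connV L M u k ν x - connV L M u' k ν x) k
        + (Pmodel L M (fun k ν x => connV L M u k ν x - connV L M u' k ν x) k)ᴴ + Matrix.diagonal (fun x => zT L M u k x - zT L M u' k x)) := by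
  rw [← covPert_sub_covPert]
  abel

omit [NeZero L] hM in
/-- along the chart at the base point the connection increment is `V_s − V₀ = n·e^{θ₀}·(1 − e^{θs})` entrywise (closed form; vanishes at `s = 0`). [folklore] -/
theorem connV_expChartAt_sub_base (A₀ B : (k : ℕ) → Fin d → (idx L M k → ℝ)) (s : ℝ) (k : ℕ) (ν : Fin d) (x : idx L M k) :
    connV L M (fun k ν x => Complex.exp (Complex.I * (A₀ k ν x : ℂ) / ((lev L k : ℕ) : ℂ) + (Complex.I * (B k ν x : ℂ) / ((lev L k : ℕ) : ℂ)) * (s : ℂ))) k ν x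
        - connV L M (fun k ν x => Complex.exp (Complex.I * (A₀ k ν x : ℂ) / ((lev L k : ℕ) : ℂ))) k ν x
      = ((lev L k : ℕ) : ℂ) * Complex.exp (Complex.I * (A₀ k ν x : ℂ) / ((lev L k : ℕ) : ℂ))
          * (1 - Complex.exp ((Complex.I * (B k ν x : ℂ) / ((lev L k : ℕ) : ℂ)) * (s : ℂ))) := by
  simp only [connV, negConn, conn, Complex.exp_add]
  ring

end Increment

end Summit.QuantumFields.BalabanUV.Beta.GAN24.ExponentialChartBaseJets

end
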